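import Mathlib
import HarnessLib
import Summits.HubbardSuperconductivity.HubbardSuperconductivity.Theorems.KLProgrammeKLRegimeTorusWtYoungJump
import Summits.HubbardSuperconductivity.HubbardSuperconductivity.Theorems.KLProgrammeKLRegimeSectorMultiplierOverlapWtKernel

/-!
# Route `KLProgramme` — engine support, route (L2): the WEIGHTED row / column / per-pair position sums of the overlap kernel
# `E(klAnisoFamily J′)·S(F̃_k)` (tree weight `klScaleWt L M β J′` on the leg positions) from weighted thin × thin character sums

Cell `gate-hubbard-kl`, seat p3 (g10); program «W2 = weighted overlap rows» (KL STATUS 2026-08-27 19:05Z), file W2e (part 2): the position-moment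
twin of p4's `…SectorMultiplierFat` §3 and of k3c2-p3's `overlap_jump_sums_le_of_neighbouring`.  These are the `cr/cc` binders
(`hrow′/hcol′`) of r2d-p2's weighted norms-step door `EngineV8.klNormsStepWt_of_sliceConsts` and the weighted re-sectorisation inputs
(k3c2-p3 18:38Z (iv)/(b)); the weighted thin × thin bound `T` is `charSumWt_klAnisoPair_le_uniform` (`…SectorMultiplierPairWtBound`) after the
weight domination `one_add_scaleWeight_le`:

* `charSumWt_klAniso_bgmFat_le` — weighted thin × fat `≤ 3·T` from weighted thin × thin `≤ T`;
* **`overlapKernelWt_sums_le_of_charSumWt_le`** (per-pair `≤ T/(βL²)`), **`overlapWt_rowSum_klAniso_bgmFat_le`** (`≤ 27·(3T/(βL²))`),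
  **`overlapWt_colSum_klAniso_bgmFat_le`** (`≤ 27·2^{n₁−n₂}·(3T/(βL²))`);
* **`overlapWt_jump_sums_le_of_neighbouring`** — `cr_w ≤ 27·3T_J/(βL²)`, `c₁, c₁r ≤ 3T_J/(βL²)`, `T_J = T + 729(2ML²)⁻¹T²`, every
  `k + 1 ≤ J′ ≤ N`, weight scale `J′`.

Everything is proved; no definitions; nothing about the model is asserted. [cite: BenfattoGiulianiMastropietro2006, §2.7 (2.66), (2.71a), §2.8 (2.77), (2.82)–(2.83)]
-/

noncomputable section

namespace Summit.HubbardSuperconductivity.HubbardSuperconductivity.Theorems.TorusFourierL2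

set_option linter.dupNamespace false -- summit = problem name (single-conjunct summit), D-0017

open Finset Complex Literature.MathematicalPhysics.QuantumLattice Literature.Probability.LatticeModels
open Summit.HubbardSuperconductivity.HubbardSuperconductivity.Theorems.KLProgrammeLegKernels
open Summit.HubbardSuperconductivity.HubbardSuperconductivity.Theorems.KLRegimeSplit
open Summit.HubbardSuperconductivity.HubbardSuperconductivity.Theorems.EngineV8
open Summit.HubbardSuperconductivity.HubbardSuperconductivity.Theorems.PerturbedFermiCurve
open scoped Real ComplexConjugate

open Classical

variable {L M : ℕ} [NeZero L] [NeZero M] {N N' : ℕ}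

/-! ### §3 Weighted thin × fat, the weighted consumables, the jump package -/

/-- **Weighted thin × fat from weighted thin × thin**: if for every neighbour `a' ∈ S_{ω₂}` the weighted `ℓ¹` character sum of
`klAniso n₁ ω₁ · klAniso n₂ a'` is `≤ T` (any nonnegative weight of the moment form), then that of `klAniso n₁ ω₁ · F̃_{n₂,ω₂}` is `≤ 3T`
(`n₂ + 1 ≤ n₁`). [cite: BenfattoGiulianiMastropietro2006, §2.7 (2.66), (2.71a)] -/
theorem charSumWt_klAniso_bgmFat_le {e₀ : ℝ} (he : 0 < e₀) (β μ : ℝ) (K : TrigPolyC4v) {a b : ℝ} (ha : 0 ≤ a) (hb : 0 ≤ b)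
    {n₁ n₂ : ℕ} (hn : n₂ + 1 ≤ n₁) (ω₁ : Fin (sectorCount n₁)) (ω₂ : Fin (sectorCount n₂)) {T : ℝ} (hT0 : 0 ≤ T)
    (hT : ∀ a' : Fin (sectorCount n₂), ∑ z : TorusSite 1 (2 * M) × TorusSite 2 L,
      (1 + a * |(((z.1 0).valMinAbs : ℤ) : ℝ)| + b * |(((z.2 0).valMinAbs : ℤ) : ℝ)| + b * |(((z.2 1).valMinAbs : ℤ) : ℝ)|) *
      ‖∑ q : TorusSite 1 (2 * M) × TorusSite 2 L, (torusChar q.1 z.1 * torusChar q.2 z.2) •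
        (klAnisoFamily L M β μ K e₀ n₁ ω₁ (⟨(q.1 0).val, ZMod.val_lt (q.1 0)⟩, q.2) *
          klAnisoFamily L M β μ K e₀ n₂ a' (⟨(q.1 0).val, ZMod.val_lt (q.1 0)⟩, q.2))‖ ≤ T) :
    ∑ z : TorusSite 1 (2 * M) × TorusSite 2 L,
      (1 + a * |(((z.1 0).valMinAbs : ℤ) : ℝ)| + b * |(((z.2 0).valMinAbs : ℤ) : ℝ)| + b * |(((z.2 1).valMinAbs : ℤ) : ℝ)|) *
      ‖∑ q : TorusSite 1 (2 * M) × TorusSite 2 L, (torusChar q.1 z.1 * torusChar q.2 z.2) •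
        (klAnisoFamily L M β μ K e₀ n₁ ω₁ (⟨(q.1 0).val, ZMod.val_lt (q.1 0)⟩, q.2) *
          bgmFatMultiplier L M e₀ β (nambuXiCT L μ K) n₂ ω₂ (⟨(q.1 0).val, ZMod.val_lt (q.1 0)⟩, q.2))‖ ≤ 3 * T := by
  set S := (univ : Finset (Fin (sectorCount n₂))).filter (fun a' : Fin (sectorCount n₂) =>
      ∃ δ : ℤ, |δ| ≤ 1 ∧ (sectorCount n₂ : ℤ) ∣ (((a' : ℕ) : ℤ) - ((ω₂ : ℕ) : ℤ) - δ)) with hS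
  have hScard : S.card ≤ 3 := card_fatNbrFin_le_three n₂ (ω₂ : ℕ)
  have hw0 : ∀ z : TorusSite 1 (2 * M) × TorusSite 2 L,
      0 ≤ 1 + a * |(((z.1 0).valMinAbs : ℤ) : ℝ)| + b * |(((z.2 0).valMinAbs : ℤ) : ℝ)| + b * |(((z.2 1).valMinAbs : ℤ) : ℝ)| :=
    fun z => by positivity
  simp_rw [klAnisoFamily_mul_bgmFatMultiplier_eq_sum he β μ K hn ω₁ ω₂]
  refine (sum_wt_norm_charSum_sum_le S _ hw0 (fun a' q => klAnisoFamily L M β μ K e₀ n₁ ω₁ (⟨(q.1 0).val, ZMod.val_lt (q.1 0)⟩, q.2) *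
    klAnisoFamily L M β μ K e₀ n₂ a' (⟨(q.1 0).val, ZMod.val_lt (q.1 0)⟩, q.2))).trans ?_
  calc _ ≤ ∑ _a ∈ S, T := Finset.sum_le_sum fun a' _ => hT a'
    _ = S.card * T := by rw [Finset.sum_const, nsmul_eq_mul]
    _ ≤ 3 * T := mul_le_mul_of_nonneg_right (by exact_mod_cast hScard) hT0

/-- **From a weighted `ℓ¹` bound of the character sums to the weighted one-kernel sizes**: if `Σ_z w_n(z)‖S_{ω′ω}(z)‖ ≤ T` for all sector pairs
(moment weight at scale `n`) then both the weighted `x`-sum and the weighted `y`-sum of one kernel are `≤ T/(βL²)`.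
[cite: BenfattoGiulianiMastropietro2006, §2.7 (2.71a)] -/
theorem overlapKernelWt_sums_le_of_charSumWt_le {β : ℝ} (hβ : 0 < β) (F' : Fin N' → FreqMomentum L M → ℂ)
    (F : Fin N → FreqMomentum L M → ℂ) (n : ℕ) {T : ℝ}
    (hT : ∀ (ω' : Fin N') (ω : Fin N), ∑ z : TorusSite 1 (2 * M) × TorusSite 2 L,
      (1 + klScale klE0 n * β / (2 * M) * |(((z.1 0).valMinAbs : ℤ) : ℝ)| + klScale klE0 n * |(((z.2 0).valMinAbs : ℤ) : ℝ)| +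
          klScale klE0 n * |(((z.2 1).valMinAbs : ℤ) : ℝ)|) *
      ‖∑ q : TorusSite 1 (2 * M) × TorusSite 2 L, (torusChar q.1 z.1 * torusChar q.2 z.2) •
        (F' ω' (⟨(q.1 0).val, ZMod.val_lt (q.1 0)⟩, q.2) * F ω (⟨(q.1 0).val, ZMod.val_lt (q.1 0)⟩, q.2))‖ ≤ T) :
    (∀ (ω' : Fin N') (ω : Fin N) (σ c : Fin 2) (y : SpaceTimeIdx L M),
      ∑ x : SpaceTimeIdx L M, ‖(sectorAnalysisMatrix L M β F' * sectorSubMatrix L M β F) (y, ((ω', σ), c)) (x, ((ω, σ), c))‖ *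
        klScaleWt L M β n {latticeLegPos (2 * (2 * M)) ((y, ((ω', σ), c)) : SpaceTimeIdx L M × SectorLeg N'),
          latticeLegPos (2 * (2 * M)) ((x, ((ω, σ), c)) : SpaceTimeIdx L M × SectorLeg N)} ≤ T / (β * (L : ℝ) ^ 2)) ∧
    (∀ (ω' : Fin N') (ω : Fin N) (σ c : Fin 2) (x : SpaceTimeIdx L M),
      ∑ y : SpaceTimeIdx L M, ‖(sectorAnalysisMatrix L M β F' * sectorSubMatrix L M β F) (y, ((ω', σ), c)) (x, ((ω, σ), c))‖ *
        klScaleWt L M β n {latticeLegPos (2 * (2 * M)) ((y, ((ω', σ), c)) : SpaceTimeIdx L M × SectorLeg N'),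
          latticeLegPos (2 * (2 * M)) ((x, ((ω, σ), c)) : SpaceTimeIdx L M × SectorLeg N)} ≤ T / (β * (L : ℝ) ^ 2)) := by
  have hL : (0 : ℝ) < L := Nat.cast_pos.2 (Nat.pos_of_ne_zero (NeZero.ne L))
  have hc : 0 ≤ 1 / (β * (L : ℝ) ^ 2) := by positivity
  refine ⟨fun ω' ω σ c y => ?_, fun ω' ω σ c x => ?_⟩
  · refine (rowSumWt_overlapKernel_le hβ F' F n ω' ω σ c y).trans ?_
    rw [div_eq_mul_one_div T (β * (L : ℝ) ^ 2), mul_comm T]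
    exact mul_le_mul_of_nonneg_left (hT ω' ω) hc
  · refine (colSumWt_overlapKernel_le hβ F' F n ω' ω σ c x).trans ?_
    rw [div_eq_mul_one_div T (β * (L : ℝ) ^ 2), mul_comm T]
    exact mul_le_mul_of_nonneg_left (hT ω' ω) hc

/-- **Weighted `hrow′` for the thin × fat pair from a uniform weighted thin × thin bound** (weight scale `n₁`, `n₂ + 1 ≤ n₁`):
`Σ_Y ‖(E(F_{n₁})S(F̃_{n₂})) Y′ Y‖·wt_{n₁}{pos Y′, pos Y} ≤ 27·(3T/(βL²))`. [cite: BenfattoGiulianiMastropietro2006, §2.7 (2.71a), §2.8 (2.77)] -/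
theorem overlapWt_rowSum_klAniso_bgmFat_le {e₀ β : ℝ} (he : 0 < e₀) (hβ : 0 < β) (μ : ℝ) (K : TrigPolyC4v) {n₁ n₂ : ℕ}
    (hn : n₂ + 1 ≤ n₁) {T : ℝ} (hT0 : 0 ≤ T)
    (hT : ∀ (ω₁ : Fin (sectorCount n₁)) (a' : Fin (sectorCount n₂)), ∑ z : TorusSite 1 (2 * M) × TorusSite 2 L,
      (1 + klScale klE0 n₁ * β / (2 * M) * |(((z.1 0).valMinAbs : ℤ) : ℝ)| + klScale klE0 n₁ * |(((z.2 0).valMinAbs : ℤ) : ℝ)| +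
          klScale klE0 n₁ * |(((z.2 1).valMinAbs : ℤ) : ℝ)|) *
      ‖∑ q : TorusSite 1 (2 * M) × TorusSite 2 L, (torusChar q.1 z.1 * torusChar q.2 z.2) •
        (klAnisoFamily L M β μ K e₀ n₁ ω₁ (⟨(q.1 0).val, ZMod.val_lt (q.1 0)⟩, q.2) *
          klAnisoFamily L M β μ K e₀ n₂ a' (⟨(q.1 0).val, ZMod.val_lt (q.1 0)⟩, q.2))‖ ≤ T)
    (Y' : SpaceTimeIdx L M × SectorLeg (sectorCount n₁)) :
    ∑ Y, ‖(sectorAnalysisMatrix L M β (klAnisoFamily L M β μ K e₀ n₁) *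
        sectorSubMatrix L M β (bgmFatMultiplier L M e₀ β (nambuXiCT L μ K) n₂)) Y' Y‖ *
        klScaleWt L M β n₁ {latticeLegPos (2 * (2 * M)) Y', latticeLegPos (2 * (2 * M)) Y} ≤ (27 : ℕ) * (3 * T / (β * (L : ℝ) ^ 2)) := by
  have hΛ : 0 ≤ klScale klE0 n₁ := (klth_klScale_pos n₁).le
  have hM : (0 : ℝ) < M := Nat.cast_pos.2 (Nat.pos_of_ne_zero (NeZero.ne M))
  have hpair := overlapKernelWt_sums_le_of_charSumWt_le hβ (klAnisoFamily L M β μ K e₀ n₁)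
    (bgmFatMultiplier L M e₀ β (nambuXiCT L μ K) n₂) n₁ (T := 3 * T)
    (fun ω₁ ω₂ => charSumWt_klAniso_bgmFat_le he β μ K (by positivity) hΛ hn ω₁ ω₂ hT0 (hT ω₁))
  have hL : (0 : ℝ) < L := Nat.cast_pos.2 (Nat.pos_of_ne_zero (NeZero.ne L))
  exact rowSum_wt_sectorAnalysis_mul_sectorSub_le β _ _
    (fun ω₁ => card_overlap_klAniso_bgmFat_coarse_le he β μ K (by omega) ω₁)
    (fun Y' Y => klScaleWt L M β n₁ {latticeLegPos (2 * (2 * M)) Y', latticeLegPos (2 * (2 * M)) Y}) (by positivity)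
    (fun ω' ω σ c y => hpair.1 ω' ω σ c y) Y'

/-- **Weighted `hcol′` for the thin × fat pair from a uniform weighted thin × thin bound** (weight scale `n₁`):
`Σ_{Y′} ‖(E(F_{n₁})S(F̃_{n₂})) Y′ Y‖·wt_{n₁}{pos Y′, pos Y} ≤ 27·2^{n₁−n₂}·(3T/(βL²))`. [cite: BenfattoGiulianiMastropietro2006, §2.7 (2.71a), §2.8 (2.77)] -/
theorem overlapWt_colSum_klAniso_bgmFat_le {e₀ β : ℝ} (he : 0 < e₀) (hβ : 0 < β) (μ : ℝ) (K : TrigPolyC4v) {n₁ n₂ : ℕ}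
    (hn : n₂ + 1 ≤ n₁) {T : ℝ} (hT0 : 0 ≤ T)
    (hT : ∀ (ω₁ : Fin (sectorCount n₁)) (a' : Fin (sectorCount n₂)), ∑ z : TorusSite 1 (2 * M) × TorusSite 2 L,
      (1 + klScale klE0 n₁ * β / (2 * M) * |(((z.1 0).valMinAbs : ℤ) : ℝ)| + klScale klE0 n₁ * |(((z.2 0).valMinAbs : ℤ) : ℝ)| +
          klScale klE0 n₁ * |(((z.2 1).valMinAbs : ℤ) : ℝ)|) *
      ‖∑ q : TorusSite 1 (2 * M) × TorusSite 2 L, (torusChar q.1 z.1 * torusChar q.2 z.2) •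
        (klAnisoFamily L M β μ K e₀ n₁ ω₁ (⟨(q.1 0).val, ZMod.val_lt (q.1 0)⟩, q.2) *
          klAnisoFamily L M β μ K e₀ n₂ a' (⟨(q.1 0).val, ZMod.val_lt (q.1 0)⟩, q.2))‖ ≤ T)
    (Y : SpaceTimeIdx L M × SectorLeg (sectorCount n₂)) :
    ∑ Y', ‖(sectorAnalysisMatrix L M β (klAnisoFamily L M β μ K e₀ n₁) *
        sectorSubMatrix L M β (bgmFatMultiplier L M e₀ β (nambuXiCT L μ K) n₂)) Y' Y‖ *
        klScaleWt L M β n₁ {latticeLegPos (2 * (2 * M)) Y', latticeLegPos (2 * (2 * M)) Y} ≤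
      (27 * 2 ^ (n₁ - n₂) : ℕ) * (3 * T / (β * (L : ℝ) ^ 2)) := by
  have hΛ : 0 ≤ klScale klE0 n₁ := (klth_klScale_pos n₁).le
  have hM : (0 : ℝ) < M := Nat.cast_pos.2 (Nat.pos_of_ne_zero (NeZero.ne M))
  have hpair := overlapKernelWt_sums_le_of_charSumWt_le hβ (klAnisoFamily L M β μ K e₀ n₁)
    (bgmFatMultiplier L M e₀ β (nambuXiCT L μ K) n₂) n₁ (T := 3 * T)
    (fun ω₁ ω₂ => charSumWt_klAniso_bgmFat_le he β μ K (by positivity) hΛ hn ω₁ ω₂ hT0 (hT ω₁))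
  have hL : (0 : ℝ) < L := Nat.cast_pos.2 (Nat.pos_of_ne_zero (NeZero.ne L))
  exact colSum_wt_sectorAnalysis_mul_sectorSub_le β _ _
    (fun ω₂ => card_overlap_klAniso_bgmFat_fine_le he β μ K (by omega) ω₂)
    (fun Y' Y => klScaleWt L M β n₁ {latticeLegPos (2 * (2 * M)) Y', latticeLegPos (2 * (2 * M)) Y}) (by positivity)
    (fun ω' ω σ c x => hpair.2 ω' ω σ c x) Y

/-- **The WEIGHTED overlap constants of `E(klAnisoFamily J′)·S(F̃_k)` at ANY jump `k + 1 ≤ J′ ≤ N` from a uniform weighted neighbouring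
bound** (weight scale `J′` on every level: the hypothesis is asked with the weight `w_n` of the finer factor's scale `n`): with
`T_J := T + 729·(2ML²)⁻¹·T²`, (i) every weighted row sum is `≤ 27·(3T_J/(βL²))` (`cr`), (ii) every weighted per-pair fine-position sum is
`≤ 3T_J/(βL²)` (`c₁`), (iii) every weighted per-pair coarse-position sum is `≤ 3T_J/(βL²)` (`c₁r`).
[cite: BenfattoGiulianiMastropietro2006, §2.7 (2.71a), §2.8 (2.77), (2.82)–(2.83)] -/
theorem overlapWt_jump_sums_le_of_neighbouring {β : ℝ} (hβ : 0 < β) (μ : ℝ) (K : TrigPolyC4v) {N : ℕ} {T : ℝ} (hT0 : 0 ≤ T)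
    {J' : ℕ}
    (hT : ∀ n : ℕ, 1 ≤ n → n ≤ N → ∀ (ω : Fin (sectorCount n)) (a' : Fin (sectorCount (n - 1))),
      ∑ z : TorusSite 1 (2 * M) × TorusSite 2 L,
        (1 + klScale klE0 J' * β / (2 * M) * |(((z.1 0).valMinAbs : ℤ) : ℝ)| + klScale klE0 J' * |(((z.2 0).valMinAbs : ℤ) : ℝ)| +
            klScale klE0 J' * |(((z.2 1).valMinAbs : ℤ) : ℝ)|) *
        ‖∑ q : TorusSite 1 (2 * M) × TorusSite 2 L, (torusChar q.1 z.1 * torusChar q.2 z.2) •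
          (klAnisoFamily L M β μ K klE0 n ω (⟨(q.1 0).val, ZMod.val_lt (q.1 0)⟩, q.2) *
            klAnisoFamily L M β μ K klE0 (n - 1) a' (⟨(q.1 0).val, ZMod.val_lt (q.1 0)⟩, q.2))‖ ≤ T)
    {k : ℕ} (hJ : k + 1 ≤ J') (hN : J' ≤ N) :
    (∀ X'' : SpaceTimeIdx L M × SectorLeg (sectorCount J'),
      ∑ X', ‖(sectorAnalysisMatrix L M β (klAnisoFamily L M β μ K klE0 J') *
        sectorSubMatrix L M β (bgmFatMultiplier L M klE0 β (nambuXiCT L μ K) k)) X'' X'‖ *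
          klScaleWt L M β J' {latticeLegPos (2 * (2 * M)) X'', latticeLegPos (2 * (2 * M)) X'} ≤
        (27 : ℕ) * (3 * (T + 729 * ((((2 * M : ℕ) : ℝ) ^ 1 * (L : ℝ) ^ 2)⁻¹ * T ^ 2)) / (β * (L : ℝ) ^ 2))) ∧
    (∀ (ω'' : Fin (sectorCount J')) (ω' : Fin (sectorCount k)) (σ c : Fin 2) (x' : SpaceTimeIdx L M),
      ∑ x'' : SpaceTimeIdx L M, ‖(sectorAnalysisMatrix L M β (klAnisoFamily L M β μ K klE0 J') *
        sectorSubMatrix L M β (bgmFatMultiplier L M klE0 β (nambuXiCT L μ K) k)) (x'', ((ω'', σ), c)) (x', ((ω', σ), c))‖ *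
          klScaleWt L M β J' {latticeLegPos (2 * (2 * M)) ((x'', ((ω'', σ), c)) : SpaceTimeIdx L M × SectorLeg (sectorCount J')),
            latticeLegPos (2 * (2 * M)) ((x', ((ω', σ), c)) : SpaceTimeIdx L M × SectorLeg (sectorCount k))} ≤
        3 * (T + 729 * ((((2 * M : ℕ) : ℝ) ^ 1 * (L : ℝ) ^ 2)⁻¹ * T ^ 2)) / (β * (L : ℝ) ^ 2)) ∧
    (∀ (ω'' : Fin (sectorCount J')) (ω' : Fin (sectorCount k)) (σ c : Fin 2) (x'' : SpaceTimeIdx L M),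
      ∑ x' : SpaceTimeIdx L M, ‖(sectorAnalysisMatrix L M β (klAnisoFamily L M β μ K klE0 J') *
        sectorSubMatrix L M β (bgmFatMultiplier L M klE0 β (nambuXiCT L μ K) k)) (x'', ((ω'', σ), c)) (x', ((ω', σ), c))‖ *
          klScaleWt L M β J' {latticeLegPos (2 * (2 * M)) ((x'', ((ω'', σ), c)) : SpaceTimeIdx L M × SectorLeg (sectorCount J')),
            latticeLegPos (2 * (2 * M)) ((x', ((ω', σ), c)) : SpaceTimeIdx L M × SectorLeg (sectorCount k))} ≤
        3 * (T + 729 * ((((2 * M : ℕ) : ℝ) ^ 1 * (L : ℝ) ^ 2)⁻¹ * T ^ 2)) / (β * (L : ℝ) ^ 2)) := by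
  have he : (0 : ℝ) < klE0 := by norm_num [klE0]
  have hΛ : 0 ≤ klScale klE0 J' := (klth_klScale_pos J').le
  have hM : (0 : ℝ) < M := Nat.cast_pos.2 (Nat.pos_of_ne_zero (NeZero.ne M))
  have ha : 0 ≤ klScale klE0 J' * β / (2 * M) := by positivity
  set TJ : ℝ := T + 729 * ((((2 * M : ℕ) : ℝ) ^ 1 * (L : ℝ) ^ 2)⁻¹ * T ^ 2) with hTJ
  have hTJ0 : 0 ≤ TJ := by
    have h1 : (0 : ℝ) ≤ ((2 * M : ℕ) : ℝ) := Nat.cast_nonneg _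
    have h2 : (0 : ℝ) ≤ L := Nat.cast_nonneg _
    positivity
  have hpair : ∀ (ω₁ : Fin (sectorCount J')) (a' : Fin (sectorCount k)), ∑ z : TorusSite 1 (2 * M) × TorusSite 2 L,
      (1 + klScale klE0 J' * β / (2 * M) * |(((z.1 0).valMinAbs : ℤ) : ℝ)| + klScale klE0 J' * |(((z.2 0).valMinAbs : ℤ) : ℝ)| +
          klScale klE0 J' * |(((z.2 1).valMinAbs : ℤ) : ℝ)|) *
      ‖∑ q : TorusSite 1 (2 * M) × TorusSite 2 L, (torusChar q.1 z.1 * torusChar q.2 z.2) •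
        (klAnisoFamily L M β μ K klE0 J' ω₁ (⟨(q.1 0).val, ZMod.val_lt (q.1 0)⟩, q.2) *
          klAnisoFamily L M β μ K klE0 k a' (⟨(q.1 0).val, ZMod.val_lt (q.1 0)⟩, q.2))‖ ≤ TJ :=
    fun ω₁ a' => charSumWt_klAnisoPair_le_of_neighbouring β μ K ha hΛ hT0 hT hJ hN ω₁ a'
  have hfat := fun (ω₁ : Fin (sectorCount J')) (ω₂ : Fin (sectorCount k)) =>
    charSumWt_klAniso_bgmFat_le (L := L) (M := M) he β μ K ha hΛ hJ ω₁ ω₂ hTJ0 (hpair ω₁)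
  have hsums := overlapKernelWt_sums_le_of_charSumWt_le hβ (klAnisoFamily L M β μ K klE0 J')
    (bgmFatMultiplier L M klE0 β (nambuXiCT L μ K) k) J' hfat
  refine ⟨fun X'' => overlapWt_rowSum_klAniso_bgmFat_le he hβ μ K hJ hTJ0 hpair X'', fun ω'' ω' σ c x' => ?_,
    fun ω'' ω' σ c x'' => ?_⟩
  · exact hsums.2 ω'' ω' σ c x'
  · exact hsums.1 ω'' ω' σ c x''

end Summit.HubbardSuperconductivity.HubbardSuperconductivity.Theorems.TorusFourierL2

end
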